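import Summits.CriticalPhenomena.PercolationContinuityZ3.Theorems.PercNearOneGluingNoHeavyPcintSignedConfigItems
import HarnessLib

/-!
# CriticalPhenomena/PercolationContinuityZ3 — Theorems/PercNearOneGluingNoHeavyPcintSignedConfigSplit.lean: splitting a prefixed configuration at its first item, and gluing an item to a prefixed configuration

Lane prim-pcint, STRUCTURE rule «numerics ⇒ structure ⇒ conjecture» (prim-pcint-2 GEN 22); sequel of …PcintSignedConfigItems.  The two directions
of the FIRST-ITEM BIJECTION behind the recursion for the prefixed classes `G(top, W, wP, S)` of …PcintSignedConfigs: a configuration of the class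
whose first item is the initial segment `I` restricts to an ITEM on `I` (sign word `S.take k`, weight `v = lwt (S.take k)`) and a configuration of
the class `G(top, W₂, wP₂, S.drop k)` on `Iᶜ`, where `W₂ = (W + v) ++ [v | wP ≠ none]` and `wP₂ = some (wP.getD 0 + v)` record the weights of the
suffixes of the extended prefix, and the item-level condition `CondOK` holds (`split_mem`); conversely gluing such a pair gives a configuration of the
class with first item `I` (`glue_mem`).  The count (sequel …PcintSignedConfigCount) follows.

HONEST FRAMING: elementary finite combinatorics.  No `sorry`; standard axioms.  Written by prim-pcint-2 gen 22 (prover-prim-pcint-2-g22-0), 2026-08-27.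
-/

namespace Summit.CriticalPhenomena.PercolationContinuityZ3.Theorems.Pcint.ChordDiag

variable {α : Type*} [LinearOrder α] [Fintype α]

/-! ### The item-level condition and the extended prefix -/

/-- The ITEM-LEVEL condition for a first item of weight `v` under prefix data `(top, W, wP)`; `whole` = the item is the whole word. [folklore] -/
def CondOK (top : Bool) (W : List ℤ) (wP : Option ℤ) (v : ℤ) (whole : Prop) : Prop :=
  (∀ w ∈ W, w + v ≠ 0) ∧ (∀ w₀, wP = some w₀ → (top = true ∧ whole) ∨ w₀ + v ≠ 0) ∧ (v ≠ 0 ∨ (top = true ∧ wP = none ∧ whole))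

/-- Weights of the proper non-empty suffixes of the prefix extended by an item of weight `v`. [folklore] -/
def W2 (W : List ℤ) (wP : Option ℤ) (v : ℤ) : List ℤ :=
  W.map (· + v) ++ match wP with
    | none => []
    | some _ => [v]

/-- Weight of the prefix extended by an item of weight `v`. [folklore] -/
def wP2 (wP : Option ℤ) (v : ℤ) : Option ℤ := some (wP.getD 0 + v)

/-- Old suffix weights shifted by `v` lie in `W2`. [folklore] -/
theorem add_mem_W2 {W : List ℤ} {wP : Option ℤ} {v w : ℤ} (h : w ∈ W) : w + v ∈ W2 W wP v :=
  List.mem_append_left _ (List.mem_map.2 ⟨w, h, rfl⟩)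

/-- With a non-empty prefix, `v` itself lies in `W2`. [folklore] -/
theorem self_mem_W2 {W : List ℤ} {w₀ v : ℤ} : v ∈ W2 W (some w₀) v :=
  List.mem_append_right _ (List.mem_singleton_self v)

/-- Membership in `W2`. [folklore] -/
theorem mem_W2 {W : List ℤ} {wP : Option ℤ} {v w' : ℤ} (h : w' ∈ W2 W wP v) : (∃ w ∈ W, w' = w + v) ∨ (wP ≠ none ∧ w' = v) := by
  unfold W2 at h
  rcases List.mem_append.1 h with h | h
  · obtain ⟨w, hw, rfl⟩ := List.mem_map.1 h
    exact Or.inl ⟨w, hw, rfl⟩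
  · cases wP with
    | none => simp at h
    | some w₀ => exact Or.inr ⟨by simp, by simpa using h⟩

/-! ### Splitting at the first item -/

section Split

variable {I : Finset α} {top : Bool} {W : List ℤ} {wP : Option ℤ}

/-- The take/drop decomposition of the sign word along the first item. [folklore] -/
theorem sw_take_drop {c : Cfg α} {S : List Bool} (hI : Init I) (hc : IsCfg c) (hcl : Closed c.1 I) (hsw : sw c = S) :
    sw (resC c I) = S.take (sw (resC c I)).length ∧ sw (resC c Iᶜ) = S.drop (sw (resC c I)).length := by
  have h := sw_eq_append hI hc hcl
  rw [hsw] at h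
  constructor
  · rw [h, List.take_left]
  · rw [h, List.drop_left]

/-- **Splitting**: a configuration of `G(top, W, wP, S)` with first item `I` gives an item on `I`, a configuration of `G(top, W₂, wP₂, S.drop k)`
on `Iᶜ`, and the item-level condition. [folklore] -/
theorem split_mem {S : List Bool} {c : Cfg α} (hI : Init I) (hIne : I.Nonempty) (hc : IsGCfg top W wP S c) (hfst : fstItem c = I) :
    CondOK top W wP (lwt (S.take (sw (resC c I)).length)) (I = Finset.univ) ∧ IsItem (S.take (sw (resC c I)).length) (resC c I) ∧
      IsGCfg top (W2 W wP (lwt (S.take (sw (resC c I)).length))) (wP2 wP (lwt (S.take (sw (resC c I)).length)))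
        (S.drop (sw (resC c I)).length) (resC c Iᶜ) := by
  classical
  obtain ⟨hc0, hsw, hA, hB, hC⟩ := hc
  have hu : (Finset.univ : Finset α).Nonempty := ⟨hIne.choose, Finset.mem_univ _⟩
  have hcl : Closed c.1 I := hfst ▸ closed_fstItem c
  have hit : Indec (resC c I) ∨ Fintype.card ↥I = 1 := by subst hfst; exact indec_or_card_fstItem hu
  have hclc : Closed c.1 Iᶜ := hc0.closed_compl hcl
  obtain ⟨htake, hdrop⟩ := sw_take_drop hI hc0 hcl hsw
  set k := (sw (resC c I)).length
  set v := lwt (S.take k) with hvdef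
  have hv : wt c I = v := by rw [wt_eq_lwt_sw_resC hcl, htake]
  -- any non-empty closed interval other than everything has non-zero weight
  have hwt : ∀ J : Finset α, J.Nonempty → J ≠ Finset.univ → Convex J → Closed c.1 J → wt c J ≠ 0 := by
    intro J hne hnu hcv hclJ
    by_cases hm : top = true ∧ wP = none
    · exact hA.1 hm J hne hnu hcv hclJ
    · exact hA.2 hm J hne hcv hclJ
  have hIcv : Convex I := hI.convex
  refine ⟨⟨fun w hw => ?_, fun w₀ hw₀ => ?_, ?_⟩, ⟨hc0.resC hcl, htake, fun J' hne hnu hcv hclJ => ?_, hit⟩,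
    ⟨hc0.resC hclc, hdrop, ⟨fun hm => ?_, fun _ J' hne hcv hclJ => ?_⟩, fun J' hne hi hclJ w' hw' => ?_, fun w₀' hw₀' J' hne hi hclJ => ?_⟩⟩
  · -- CondOK (i)
    rw [← hv]; exact hB I hIne hI hcl w hw
  · -- CondOK (ii)
    rw [← hv]; exact hC w₀ hw₀ I hIne hI hcl
  · -- CondOK (iii)
    by_cases hIu : I = Finset.univ
    · by_cases hm : top = true ∧ wP = none
      · exact Or.inr ⟨hm.1, hm.2, hIu⟩
      · left; rw [← hv]; exact hA.2 hm I hIne hIcv hcl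
    · left; rw [← hv]; exact hwt I hIne hIu hIcv hcl
  · -- the item has no proper closed interval of weight zero
    rw [wt_resC hcl]
    refine hwt _ ((up_nonempty_iff J').2 hne) (fun h => hnu ?_) ((convex_up_iff hIcv J').2 hcv) ((closed_resC_iff hcl J').1 hclJ)
    have hIu : I = Finset.univ := Finset.eq_univ_of_forall fun x => up_subset J' (h ▸ Finset.mem_univ x)
    rw [← up_eq_iff_eq_univ, h, hIu]
  · -- the rest: mode is never (top, none)
    exact absurd hm.2 (by simp [wP2])
  · -- the rest is FullSAW
    rw [wt_resC hclc]
    refine hwt _ ((up_nonempty_iff J').2 hne) (fun h => ?_) ((convex_up_iff (convex_compl_of_init hI) J').2 hcv)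
      ((closed_resC_iff hclc J').1 hclJ)
    obtain ⟨a, ha⟩ := hIne
    have : a ∈ up J' := h ▸ Finset.mem_univ a
    exact Finset.mem_compl.1 (up_subset J' this) ha
  · -- CondB of the rest
    have hJ : wt c (I ∪ up J') = v + wt (resC c Iᶜ) J' := by
      rw [wt_eq_of_subset hcl hc0 Finset.subset_union_left, htake, subtype_union_up]
    have hJne : (I ∪ up J').Nonempty := hIne.mono Finset.subset_union_left
    have hJi : Init (I ∪ up J') := init_union_up hI hi
    have hJcl : Closed c.1 (I ∪ up J') := closed_union_up hcl hc0 hclJ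
    rcases mem_W2 hw' with ⟨w, hw, rfl⟩ | ⟨hne', rfl⟩
    · have := hB _ hJne hJi hJcl w hw
      rw [hJ] at this; rwa [add_assoc]
    · have hm : ¬(top = true ∧ wP = none) := fun h => hne' h.2
      have := hA.2 hm _ hJne hJi.convex hJcl
      rwa [hJ] at this
  · -- CondC of the rest
    have hJ : wt c (I ∪ up J') = v + wt (resC c Iᶜ) J' := by
      rw [wt_eq_of_subset hcl hc0 Finset.subset_union_left, htake, subtype_union_up]
    have hJne : (I ∪ up J').Nonempty := hIne.mono Finset.subset_union_left
    have hJi : Init (I ∪ up J') := init_union_up hI hi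
    have hJcl : Closed c.1 (I ∪ up J') := closed_union_up hcl hc0 hclJ
    have hw₀' : w₀' = wP.getD 0 + v := by simpa [wP2] using hw₀'.symm
    subst hw₀'
    cases hwP : wP with
    | some w₀ =>
      rw [hwP] at hC
      rcases hC w₀ rfl _ hJne hJi hJcl with ⟨ht, hu'⟩ | h
      · exact Or.inl ⟨ht, (union_up_eq_univ_iff J').1 hu'⟩
      · right; rw [hJ] at h; simpa [add_assoc] using h
    | none =>
      rw [hwP] at hA
      by_cases ht : top = true
      · by_cases hu' : J' = Finset.univ
        · exact Or.inl ⟨ht, hu'⟩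
        · right
          have := hA.1 ⟨ht, rfl⟩ _ hJne (fun h => hu' ((union_up_eq_univ_iff J').1 h)) hJi.convex hJcl
          rw [hJ] at this; simpa using this
      · right
        have := hA.2 (fun h => ht h.1) _ hJne hJi.convex hJcl
        rw [hJ] at this; simpa using this

/-! ### Gluing an item to a prefixed configuration -/

/-- **Gluing**: an item on the non-empty initial segment `I` and a configuration of `G(top, W₂, wP₂, S')` on `Iᶜ` satisfying the item-level
condition glue to a configuration of `G(top, W, wP, T ++ S')` whose first item is `I`. [folklore] -/
theorem glue_mem {T S' : List Bool} {item : Cfg ↥I} {rest : Cfg ↥(Iᶜ)} (hI : Init I) (hIne : I.Nonempty) (hitem : IsItem T item)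
    (hrest : IsGCfg top (W2 W wP (lwt T)) (wP2 wP (lwt T)) S' rest) (hok : CondOK top W wP (lwt T) (I = Finset.univ)) :
    IsGCfg top W wP (T ++ S') (glueC I rest item) ∧ fstItem (glueC I rest item) = I := by
  classical
  set c := glueC I rest item with hcdef
  obtain ⟨hi0, hisw, hiP, hit'⟩ := hitem
  obtain ⟨hr0, hrsw, hrA, hrB, hrC⟩ := hrest
  have hcl : Closed c.1 I := closed_glueC
  have hc0 : IsCfg c := hr0.glueC hi0
  have hclc : Closed c.1 Iᶜ := hc0.closed_compl hcl
  have hri : resC c I = item := resC_glueC_right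
  have hrr : resC c Iᶜ = rest := resC_glueC_left
  have hit : Indec (resC c I) ∨ Fintype.card ↥I = 1 := by rw [hri]; exact hit'
  have hIcv : Convex I := hI.convex
  set v := lwt T with hvdef
  have hv : wt c I = v := by rw [wt_eq_lwt_sw_resC hcl, hri, hisw]
  -- weights of sets containing `I`
  have hwJ : ∀ J : Finset α, I ⊆ J → wt c J = v + wt rest (J.subtype (· ∈ Iᶜ)) := fun J hJ => by
    rw [wt_eq_of_subset hcl hc0 hJ, hri, hisw, hrr]
  -- the rest is FullSAW
  have hrF : FullSAW rest := hrA.2 (by simp [wP2])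
  -- closed sets containing `I`: the trace on `Iᶜ` is closed for the rest
  have hclJ' : ∀ J : Finset α, Closed c.1 J → Closed rest.1 (J.subtype (· ∈ Iᶜ)) := fun J hJ => by
    rw [← hrr, closed_resC_iff hclc, up_subtype]
    intro x hx
    rw [Finset.mem_filter] at hx ⊢
    exact ⟨hJ hx.1, hclc hx.2⟩
  -- first item
  have hfst : fstItem c = I := by
    refine Finset.Subset.antisymm (fstItem_subset hIne hI hcl) fun x hx => mem_fstItem.2 fun J hne hi hclJ => ?_
    exact subset_of_init_closed hI hIne hcl hit hne hi hclJ hx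
  -- sets containing `I`: `J = I ∪ up J'` with `J'` the trace on `Iᶜ`
  have hJeq : ∀ J : Finset α, I ⊆ J → J = I ∪ up (J.subtype (· ∈ Iᶜ)) := fun J hJ => eq_union_up_of_subset hJ
  -- the key estimate: closed intervals have non-zero weight (all of them unless at the top with empty prefix, where `univ` is exempt)
  have key : ∀ J : Finset α, J.Nonempty → Convex J → Closed c.1 J → (J ≠ Finset.univ ∨ ¬(top = true ∧ wP = none)) → wt c J ≠ 0 := by
    intro J hne hcv hclJ hex
    by_cases ha : ∃ a ∈ J, a ∈ I <;> by_cases hb : ∃ b ∈ J, b ∉ I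
    · -- `J` meets `I` and `Iᶜ`: it contains `I`
      obtain ⟨a, haJ, haI⟩ := ha
      obtain ⟨b, hbJ, hbI⟩ := hb
      have hIJ : I ⊆ J := subset_of_convex_closed hc0 hI hcl hit hcv hclJ haJ haI hbJ hbI
      have hJi : Init J := fun x hx y hyx => by
        by_cases hyI : y ∈ I
        · exact hIJ hyI
        · obtain ⟨m, hm⟩ := hIne
          have hmy : m ≤ y := le_of_not_ge fun h => hyI (hI hm h)
          exact hcv (hIJ hm) hx hmy hyx
      set J' := J.subtype (· ∈ Iᶜ)
      have hne' : J'.Nonempty := ⟨⟨b, Finset.mem_compl.2 hbI⟩, Finset.mem_subtype.2 hbJ⟩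
      have hi' : Init J' := init_subtype_compl hJi
      have hcl' : Closed rest.1 J' := hclJ' J hclJ
      rw [hwJ J hIJ]
      cases hwP : wP with
      | some w₀ =>
        rw [hwP] at hrB
        exact hrB J' hne' hi' hcl' v self_mem_W2
      | none =>
        rw [hwP] at hrC
        rcases hrC (0 + v) (by simp [wP2]) J' hne' hi' hcl' with ⟨ht, hu'⟩ | h
        · exfalso
          have hJu : J = Finset.univ := by rw [hJeq J hIJ]; exact (union_up_eq_univ_iff J').2 hu'
          rcases hex with h | h
          · exact h hJu
          · exact h ⟨ht, hwP⟩
        · simpa using h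
    · -- `J ⊆ I`
      obtain ⟨a, haJ, haI⟩ := ha
      push Not at hb
      have hJI : J ⊆ I := fun x hx => hb x hx
      by_cases hJe : J = I
      · rw [hJe, hv]
        rcases hok.2.2 with h | ⟨ht, hn, hu'⟩
        · exact h
        · exfalso
          rcases hex with h | h
          · exact h (hJe.trans hu')
          · exact h ⟨ht, hn⟩
      · set J' := J.subtype (· ∈ I)
        have hupJ : up J' = J := up_subtype_of_subset hJI
        have hne' : J'.Nonempty := ⟨⟨a, haI⟩, Finset.mem_subtype.2 haJ⟩
        have hnu' : J' ≠ Finset.univ := fun h => hJe ?_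
        · rw [wt_eq_of_subset_part hcl hJI, hri]
          refine hiP J' hne' hnu' ?_ ?_
          · rw [← convex_up_iff hIcv J', hupJ]; exact hcv
          · rw [← hri, closed_resC_iff hcl J', hupJ]; exact hclJ
        · rw [← hupJ, h, up_univ]
    · -- `J ⊆ Iᶜ`
      push Not at ha
      obtain ⟨b, hbJ, hbI⟩ := hb
      have hJI : J ⊆ Iᶜ := fun x hx => Finset.mem_compl.2 (ha x hx)
      set J' := J.subtype (· ∈ Iᶜ)
      have hupJ : up J' = J := up_subtype_of_subset hJI
      rw [wt_eq_of_subset_part hclc hJI, hrr]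
      refine hrF J' ⟨⟨b, Finset.mem_compl.2 hbI⟩, Finset.mem_subtype.2 hbJ⟩ ?_ ?_
      · rw [← convex_up_iff (convex_compl_of_init hI) J', hupJ]; exact hcv
      · rw [← hrr, closed_resC_iff hclc J', hupJ]; exact hclJ
    · exfalso
      obtain ⟨a, ha'⟩ := hne
      push Not at ha hb
      exact ha a ha' (hb a ha')
  refine ⟨⟨hc0, ?_, ⟨fun hm J hne hnu hcv hclJ => key J hne hcv hclJ (Or.inl hnu), fun hm J hne hcv hclJ =>
    key J hne hcv hclJ (Or.inr hm)⟩, fun J hne hi hclJ w hw => ?_, fun w₀ hw₀ J hne hi hclJ => ?_⟩, hfst⟩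
  · rw [sw_eq_append hI hc0 hcl, hri, hrr, hisw, hrsw]
  · -- CondB
    have hIJ : I ⊆ J := subset_of_init_closed hI hIne hcl hit hne hi hclJ
    set J' := J.subtype (· ∈ Iᶜ)
    by_cases hJ' : J' = ∅
    · have hJI : J = I := by
        rw [hJeq J hIJ]; change I ∪ up J' = I; rw [hJ', (up_eq_empty_iff (∅ : Finset ↥(Iᶜ))).2 rfl, Finset.union_empty]
      rw [hJI, hv]; exact hok.1 w hw
    · have := hrB J' (Finset.nonempty_iff_ne_empty.2 hJ') (init_subtype_compl hi) (hclJ' J hclJ) (w + v) (add_mem_W2 hw)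
      rw [hwJ J hIJ, ← add_assoc]; exact this
  · -- CondC
    have hIJ : I ⊆ J := subset_of_init_closed hI hIne hcl hit hne hi hclJ
    set J' := J.subtype (· ∈ Iᶜ)
    by_cases hJ' : J' = ∅
    · have hJI : J = I := by
        rw [hJeq J hIJ]; change I ∪ up J' = I; rw [hJ', (up_eq_empty_iff (∅ : Finset ↥(Iᶜ))).2 rfl, Finset.union_empty]
      rw [hJI, hv]; exact hok.2.1 w₀ hw₀
    · rcases hrC (w₀ + v) (by simp [wP2, hw₀]) J' (Finset.nonempty_iff_ne_empty.2 hJ') (init_subtype_compl hi) (hclJ' J hclJ)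
        with ⟨ht, hu'⟩ | h
      · left
        refine ⟨ht, ?_⟩
        rw [hJeq J hIJ]; exact (union_up_eq_univ_iff J').2 hu'
      · right
        rw [hwJ J hIJ, ← add_assoc]; exact h

end Split

end Summit.CriticalPhenomena.PercolationContinuityZ3.Theorems.Pcint.ChordDiag
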